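import Literature.NumberTheory.LFunctions.WeilTwoPrimeDeflL2Def
import Literature.NumberTheory.LFunctions.WeilTwoPrimeDeflL2DataPE24
import Literature.NumberTheory.LFunctions.WeilBlockRowsR
import HarnessLib

/-!
# Deflated two-prime certificate L2: the materialized even block agrees with `P_r + Σ μ ĉ ĉᵀ`, rows 10–19

`WeilCert.checkPmRowG` for certificate L2 (even block), by `decide +kernel`. Pure proof file; nothing is asserted.
-/

noncomputable section

namespace Literature.NumberTheory.LFunctions

set_option maxHeartbeats 0 in
/-- Row 10 of the materialized even block is row 10 of `P_r + Σ μ ĉ ĉᵀ` (certificate L2). [folklore] -/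
theorem checkPmRowG0_10_weilCertDeflL2 : weilCertDeflL2Base.checkPmRowG weilCertDeflL2P weilCertDeflL2PmE 0 10 = true := by
  decide +kernel

set_option maxHeartbeats 0 in
/-- Row 11 of the materialized even block is row 11 of `P_r + Σ μ ĉ ĉᵀ` (certificate L2). [folklore] -/
theorem checkPmRowG0_11_weilCertDeflL2 : weilCertDeflL2Base.checkPmRowG weilCertDeflL2P weilCertDeflL2PmE 0 11 = true := by
  decide +kernel

set_option maxHeartbeats 0 in
/-- Row 12 of the materialized even block is row 12 of `P_r + Σ μ ĉ ĉᵀ` (certificate L2). [folklore] -/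
theorem checkPmRowG0_12_weilCertDeflL2 : weilCertDeflL2Base.checkPmRowG weilCertDeflL2P weilCertDeflL2PmE 0 12 = true := by
  decide +kernel

set_option maxHeartbeats 0 in
/-- Row 13 of the materialized even block is row 13 of `P_r + Σ μ ĉ ĉᵀ` (certificate L2). [folklore] -/
theorem checkPmRowG0_13_weilCertDeflL2 : weilCertDeflL2Base.checkPmRowG weilCertDeflL2P weilCertDeflL2PmE 0 13 = true := by
  decide +kernel

set_option maxHeartbeats 0 in
/-- Row 14 of the materialized even block is row 14 of `P_r + Σ μ ĉ ĉᵀ` (certificate L2). [folklore] -/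
theorem checkPmRowG0_14_weilCertDeflL2 : weilCertDeflL2Base.checkPmRowG weilCertDeflL2P weilCertDeflL2PmE 0 14 = true := by
  decide +kernel

set_option maxHeartbeats 0 in
/-- Row 15 of the materialized even block is row 15 of `P_r + Σ μ ĉ ĉᵀ` (certificate L2). [folklore] -/
theorem checkPmRowG0_15_weilCertDeflL2 : weilCertDeflL2Base.checkPmRowG weilCertDeflL2P weilCertDeflL2PmE 0 15 = true := by
  decide +kernel

set_option maxHeartbeats 0 in
/-- Row 16 of the materialized even block is row 16 of `P_r + Σ μ ĉ ĉᵀ` (certificate L2). [folklore] -/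
theorem checkPmRowG0_16_weilCertDeflL2 : weilCertDeflL2Base.checkPmRowG weilCertDeflL2P weilCertDeflL2PmE 0 16 = true := by
  decide +kernel

set_option maxHeartbeats 0 in
/-- Row 17 of the materialized even block is row 17 of `P_r + Σ μ ĉ ĉᵀ` (certificate L2). [folklore] -/
theorem checkPmRowG0_17_weilCertDeflL2 : weilCertDeflL2Base.checkPmRowG weilCertDeflL2P weilCertDeflL2PmE 0 17 = true := by
  decide +kernel

set_option maxHeartbeats 0 in
/-- Row 18 of the materialized even block is row 18 of `P_r + Σ μ ĉ ĉᵀ` (certificate L2). [folklore] -/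
theorem checkPmRowG0_18_weilCertDeflL2 : weilCertDeflL2Base.checkPmRowG weilCertDeflL2P weilCertDeflL2PmE 0 18 = true := by
  decide +kernel

set_option maxHeartbeats 0 in
/-- Row 19 of the materialized even block is row 19 of `P_r + Σ μ ĉ ĉᵀ` (certificate L2). [folklore] -/
theorem checkPmRowG0_19_weilCertDeflL2 : weilCertDeflL2Base.checkPmRowG weilCertDeflL2P weilCertDeflL2PmE 0 19 = true := by
  decide +kernel


end Literature.NumberTheory.LFunctions
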